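import Mathlib.Analysis.Convolution
import Literature.Analysis.FluidPDE.NormalisedPressureFarField
import Literature.Analysis.FluidPDE.NewtonPotentialRepresentation
import Literature.Analysis.FluidPDE.NormalisedPressureDischarge
import HarnessLib

/-!
# Smoothness of the pressure of a compactly supported field, jointly in parameters

Analysis/FluidPDE support file (serves the formalisation of Scheffer's construction of singular
weak solutions of the Navier–Stokes inequality in the presentation of W. S. Ożański,
arXiv:1709.00602: §3.2 "if `u ∈ C_0^∞(ℝ³)` then the corresponding pressure function is smooth
on `ℝ³`" (before (3.4)), §3.3 (3.11) "`p[v,f] ∈ C^∞(ℝ²)`", and the time-dependent pressure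
functions `p[a(t)v, h_t]`, `p[aᵢᵏ(t)vᵢ, q^k_{i,t}]` of §4 (Lemma 8, (4.15), Prop. 9), which are
differentiated in `x` and integrated/differentiated in `t`).

The tree's normalised pressure `p̃[v] = normalisedPressure v` (`-Δ⁻¹∂ᵢ∂ⱼ(vᵢvⱼ)`) of a compactly
supported `C²` field is the Newtonian potential of the source `G[v] = ∂ᵢ∂ⱼ(vᵢvⱼ)`
(`normalisedPressure_eq_integral_newton`, `NormalisedPressureFarField`); here this is recast as a
Mathlib convolution and the convolution calculus is applied:

* `normalisedPressure_eq_neg_convolution` — `p̃[v] = -(Γ ⋆ G[v])`, `Γ(z) = -1/(4π|z|) ∈ L¹_loc`;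
* `contDiff_normalisedPressure` — **`v ∈ C^{n+2}_c ⇒ p̃[v] ∈ Cⁿ`**, in particular
  `contDiff_normalisedPressure_of_contDiff_infty` — `v ∈ C^∞_c ⇒ p̃[v] ∈ C^∞`
  (Ożański 2017, §3.2; the tree previously had `C²`, `contDiff_pressurePotential`);
* `isSmoothSpaceTimeOn_normalisedPressure` — **joint smoothness in a parameter**: if
  `u : ℝ → ℝ³ → ℝ³` is jointly `C^∞` on `S × ℝ³` for an OPEN time set `S` and its slices vanish
  off a fixed compact set, then `(t, x) ↦ p̃[u(t)](x)` is jointly `C^∞` on `S × ℝ³`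
  (Mathlib's `contDiffOn_convolution_right_with_param` applied to the jointly smooth,
  uniformly compactly supported source `(t, y) ↦ G[u(t)](y)`).

## Mathlib / tree search

Mathlib: `MeasureTheory.convolution`, `convolution_eq_swap`, `HasCompactSupport.contDiff_convolution_right`,
`contDiffOn_convolution_right_with_param` (used). Tree: `locallyIntegrable_newtonKernel`
(`NewtonPotentialRepresentation`), `IsSmoothSpaceTimeOn.pressureSource`
(`NormalisedPressureDischarge`), `pressurePotential_eq_neg_integral_newtonKernel_mul_pressureSource`,
`tsupport_pressureSource_subset` (`NormalisedPressureFarField`).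

## References

* W. S. Ożański, *On weak solutions to the Navier–Stokes inequality with internal
  singularities*, arXiv:1709.00602 (2017), §3.2 (before (3.4)), §3.3 (3.11), §4.
  [`Ozanski2017NSISingular`]
* D. Gilbarg, N. S. Trudinger, *Elliptic partial differential equations of second order* (2001),
  Lemma 4.1–4.2. [`GilbargTrudinger2001`]
-/

noncomputable section

open MeasureTheory Set Filter Metric Topology Function Real
open scoped RealInnerProductSpace ContDiff ENNReal Convolution

namespace Literature.Analysis.FluidPDE

open NewtonPotentialRepresentation (locallyIntegrable_newtonKernel)

-- nested operator types `ℝ³ →L[ℝ] ℝ³ →L[ℝ] ℝ`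
set_option maxSynthPendingDepth 3

variable {v : (EuclideanSpace ℝ (Fin 3)) → (EuclideanSpace ℝ (Fin 3))}

/-! ### The pressure as a convolution with the Newtonian kernel -/

/-- **`p̃[v] = -(Γ ⋆ G[v])`** for `v ∈ C²_c(ℝ³; ℝ³)`: the normalised pressure is minus the Mathlib
convolution of the Newtonian kernel `Γ(z) = -1/(4π|z|)` with the source
`G[v] = ∂ᵢ∂ⱼ(vᵢvⱼ)` (Ożański 2017, (3.3); Gilbarg–Trudinger, Lemma 4.2). [cite: Ozanski2017NSISingular, §3.2 (3.3)] -/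
theorem normalisedPressure_eq_neg_convolution (hv : ContDiff ℝ 2 v) (hc : HasCompactSupport v) :
    normalisedPressure v =
      -(newtonKernel ⋆[ContinuousLinearMap.lsmul ℝ ℝ, volume] pressureSource v) := by
  have hL2 : Integrable fun y => ‖v y‖ ^ 2 :=
    (hv.continuous.norm.pow 2).integrable_of_hasCompactSupport
      (HasCompactSupport.intro (K := tsupport v) hc fun y hy => by
        simp [image_eq_zero_of_notMem_tsupport hy])
  funext x
  rw [Pi.neg_apply, convolution_eq_swap, normalisedPressure_eq_pressurePotential hv hL2 x,
    pressurePotential_eq_neg_integral_newtonKernel_mul_pressureSource hv hc x]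
  simp only [ContinuousLinearMap.lsmul_apply, smul_eq_mul]

/-! ### Smoothness -/

/-- The source `G[v] = ∂ᵢ∂ⱼ(vᵢvⱼ)` of a compactly supported field is compactly supported. [folklore] -/
theorem hasCompactSupport_pressureSource (hc : HasCompactSupport v) :
    HasCompactSupport (pressureSource v) :=
  hc.of_isClosed_subset (isClosed_tsupport _) (tsupport_pressureSource_subset v)

/-- **`v ∈ C^{n+2}_c ⇒ p̃[v] ∈ Cⁿ`** (the Newtonian kernel is locally integrable and
`G[v] ∈ Cⁿ_c`; Ożański 2017, §3.2: "the corresponding pressure function is smooth").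
[cite: Ozanski2017NSISingular, §3.2] -/
theorem contDiff_normalisedPressure {n : ℕ∞} (hv : ContDiff ℝ (n + 2) v)
    (hc : HasCompactSupport v) : ContDiff ℝ n (normalisedPressure v) := by
  have hv2 : ContDiff ℝ 2 v := hv.of_le (by
    change ((2 : ℕ∞) : WithTop ℕ∞) ≤ ((n + 2 : ℕ∞) : WithTop ℕ∞)
    exact_mod_cast le_add_self)
  rw [normalisedPressure_eq_neg_convolution hv2 hc]
  exact ((hasCompactSupport_pressureSource hc).contDiff_convolution_right
    (ContinuousLinearMap.lsmul ℝ ℝ) locallyIntegrable_newtonKernel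
    (contDiff_pressureSource hv)).neg

/-- **`v ∈ C^∞_c ⇒ p̃[v] ∈ C^∞`** (Ożański 2017, §3.2, before (3.4); §3.3 (3.11)).
[cite: Ozanski2017NSISingular, §3.2] -/
theorem contDiff_normalisedPressure_of_contDiff_infty (hv : ContDiff ℝ ∞ v)
    (hc : HasCompactSupport v) : ContDiff ℝ ∞ (normalisedPressure v) :=
  contDiff_infty.2 fun n => contDiff_normalisedPressure (n := n) (hv.of_le (by
    change ((n + 2 : ℕ∞) : WithTop ℕ∞) ≤ ((⊤ : ℕ∞) : WithTop ℕ∞)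
    exact_mod_cast le_top)) hc

/-! ### Joint smoothness in a parameter (time) -/

variable {S : Set ℝ} {u : ℝ → (EuclideanSpace ℝ (Fin 3)) → (EuclideanSpace ℝ (Fin 3))} {K : Set (EuclideanSpace ℝ (Fin 3))}

/-- The sources `G[u(t)]` of a family whose slices vanish off `K` vanish off `K`. [folklore] -/
theorem pressureSource_slice_eq_zero_of_notMem (hK : IsClosed K) (h0 : ∀ t ∈ S, ∀ x ∉ K, u t x = 0)
    {t : ℝ} (ht : t ∈ S) {x : (EuclideanSpace ℝ (Fin 3))} (hx : x ∉ K) : pressureSource (u t) x = 0 := by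
  refine pressureSource_apply_eq_zero_of_notMem_tsupport fun hmem => hx ?_
  have hsub : tsupport (u t) ⊆ K :=
    closure_minimal (fun y hy => by
      by_contra hyK
      exact hy (h0 t ht y hyK)) hK
  exact hsub hmem

/-- **Joint smoothness of the pressure along a smooth compactly supported family.** Let `S ⊆ ℝ`
be OPEN and `u : ℝ → ℝ³ → ℝ³` jointly `C^∞` on `S × ℝ³` (`IsSmoothSpaceTimeOn S u`) with
`u(t, x) = 0` for `x` outside a fixed compact set `K`, for all `t ∈ S`. Then
`(t, x) ↦ p̃[u(t)](x)` is jointly `C^∞` on `S × ℝ³`: `p̃[u(t)] = -(Γ ⋆ G[u(t)])` with `Γ ∈ L¹_loc`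
and the source `(t, y) ↦ G[u(t)](y)` jointly smooth and supported in `K` (Mathlib
`contDiffOn_convolution_right_with_param`). This is the regularity used tacitly for the
time-dependent pressure functions of Ożański 2017, §4. [cite: Ozanski2017NSISingular, §4 (4.15) and Prop. 9] -/
theorem isSmoothSpaceTimeOn_normalisedPressure (hS : IsOpen S) (hu : IsSmoothSpaceTimeOn S u)
    (hK : IsCompact K) (h0 : ∀ t ∈ S, ∀ x ∉ K, u t x = 0) :
    IsSmoothSpaceTimeOn S fun t x => normalisedPressure (u t) x := by
  have hSd : UniqueDiffOn ℝ S := hS.uniqueDiffOn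
  -- joint smoothness and support of the source
  have hG : ContDiffOn ℝ ∞ (↿fun t y => pressureSource (u t) y) (S ×ˢ univ) := hu.pressureSource hSd
  have hG0 : ∀ t, ∀ y, t ∈ S → y ∉ K → pressureSource (u t) y = 0 := fun t y ht hy =>
    pressureSource_slice_eq_zero_of_notMem hK.isClosed h0 ht hy
  -- the parametric convolution is jointly smooth
  have hconv := contDiffOn_convolution_right_with_param (𝕜 := ℝ) (n := (⊤ : ℕ∞))
    (ContinuousLinearMap.lsmul ℝ ℝ) (μ := volume) hS hK hG0 locallyIntegrable_newtonKernel hG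
  -- identify the slices
  have hslice : ∀ t ∈ S, (fun x => normalisedPressure (u t) x) = fun x =>
      -(newtonKernel ⋆[ContinuousLinearMap.lsmul ℝ ℝ, volume] pressureSource (u t)) x := by
    intro t ht
    have hc : HasCompactSupport (u t) :=
      HasCompactSupport.intro hK fun x hx => h0 t ht x hx
    have h2 : ContDiff ℝ 2 (u t) := (hu.contDiff_slice ht).of_le (by
      change ((2 : ℕ∞) : WithTop ℕ∞) ≤ ((⊤ : ℕ∞) : WithTop ℕ∞)
      exact_mod_cast le_top)
    rw [normalisedPressure_eq_neg_convolution h2 hc]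
    rfl
  refine (hconv.neg).congr ?_
  rintro ⟨t, x⟩ ⟨ht, -⟩
  exact congrFun (hslice t ht) x

end Literature.Analysis.FluidPDE

end
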